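import Summits.AnomalousDissipation.AnomalousDissipation.Theorems.TwoAndHalfDTwohalfdNegRegularCondensateRestartTools
import HarnessLib

/-!
# Restarting a sourced weak passive scalar at almost every time (stub RC-R)

Crux `TwoAndHalfD.TwohalfdNeg` (stmt-AnomalousDissipation-0211), line
`log-kantorovich-enstrophy-transfer`, regular-condensate theorem (lead c7), stub RC-R.

For a global weak solution `θ` of `∂ₜθ + u·∇θ = κΔθ + h` on `T²` (`Torus.IsWeakScalarTransportForced`,
the DISTRIBUTIONAL notion: `θ ∈ L^∞L²`, `u ∈ L¹L²`, `uθ ∈ L¹`, source in `L¹`, weak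
incompressibility a.e., and the weak identity against smooth space–time test functions) with a
steady smooth source `h` and an `L²` datum, for a.e. `a > 0` the slice `θ a` is in `L²` and the
shifted field `t ↦ θ (a + t)` is again a global weak solution, over the shifted drift
`t ↦ u (a + t)`, with datum `θ a` (`stub_rcRestart`).

* `weak_eq_translate` — the weak identity of the translate with datum `θ(a)` at a GOOD time `a`
  (one where `∫ θ(a) g = P_g(a)` for every smooth `g`, `P_g` the absolutely continuous trace):
  test the original identity on `[0, T + a)` with `η_δ(τ - a) ψ(τ - a, x)`, `η_δ` a smooth
  monotone cut-off (`exists_smooth_time_cutoff`), so that the datum term drops, and let `δ → 0`;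
  the `η_δ'`-term tends to `∫ θ(a) ψ(0)` by the a.e. right limit of the pairing
  (`exists_ae_abs_pairing_translate_sub_le`, tools file). This is the cut-off argument of the
  Leray–Hopf twin `LerayHopfTranslateTorus` (Robinson–Rodrigo–Sadowski 2016, §3.1), the trace now
  coming from DiPerna–Lions' mollified primitive instead of strong continuity.
* `isWeakScalarTransportForcedOn_translate` — all other conjuncts translate along the
  measure-preserving shear `(t, y) ↦ (t + a, y)`.
* `stub_rcRestart` — the registered stub (last declaration): the good times have full measure
  (`ae_memLp_and_forall_integral_mul_eq_trace`, tools file; countable intersection over kernels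
  and integer horizons).

Supports stmt-AnomalousDissipation-0211. Sources: R. J. DiPerna, P.-L. Lions, Invent. Math. 98
(1989), §II.1 (13)–(14) [`DiPernaLions1989`]; J. C. Robinson, J. L. Rodrigo, W. Sadowski, *The
three-dimensional Navier–Stokes equations* (2016), §3.1 and Def. 3.3 (ii)
[`RobinsonRodrigoSadowski2016`]. Not here: energy inequalities of the restarted solution
(stub RC-K), uniqueness.
-/

noncomputable section

namespace Summit.AnomalousDissipation.AnomalousDissipation.Theorems.TwohalfdNeg.RegularCondensate

open MeasureTheory Filter Topology Set Function Metric
open scoped ENNReal NNReal InnerProductSpace Convolution ContDiff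
open Literature.Analysis.FunctionSpaces Literature.Analysis.FluidPDE

-- the summit and the problem are both `AnomalousDissipation` (path convention), hence the dup:
set_option linter.dupNamespace false

variable {d : Type*} [Fintype d]

section Translate

variable {T κ a : ℝ} {u : ℝ → UnitAddTorus d → EuclideanSpace ℝ d} {s : ℝ → UnitAddTorus d → ℝ}
  {θ₀ : UnitAddTorus d → ℝ} {θ : ℝ → UnitAddTorus d → ℝ}

/-- **The weak identity of the translate, with datum `θ(a)`.** Let `θ` be a weak solution of
`∂ₜθ + u·∇θ = κΔθ + s` on `T^d × [0, T + a)` (`T, a > 0`) such that the slice `θ(a)`, paired with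
every smooth `g`, is the trace `P_g(a) = ∫ θ₀ g + ∫_{(0,a]} (∫ θ (⟪u, ∇g⟫ + κΔg) + ∫ s g)`. Then for
every space–time test function `ψ` on `[0, T)`,
`∫₀ᵀ∫ θ(t+a) (∂ₜψ + u(t+a)·∇ψ + κΔψ) + ∫₀ᵀ∫ s(t+a) ψ + ∫ θ(a) ψ(0) = 0`:
test the weak formulation of `θ` with `η_δ(τ - a) ψ(τ - a, x)`, `η_δ` a smooth monotone cut-off
vanishing on `(-∞, δ]` and equal to `1` on `[3δ, ∞)` (the datum term drops), and let `δ → 0`: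
`∫ η_δ(τ - a) Φ(τ) dτ → ∫_{(a, T+a)} Φ` by dominated convergence and
`∫ η_δ'(τ - a) ∫ θ(τ) ψ(τ - a) dτ → ∫ θ(a) ψ(0)` because the pairing `t ↦ ∫ θ(t + a) ψ(t)` tends
to `∫ θ(a) ψ(0)` along a.e. `t → 0⁺` (`exists_ae_abs_pairing_translate_sub_le`). This is the
cut-off argument of Robinson–Rodrigo–Sadowski 2016, §3.1, for the scalar equation, with the trace
supplied by DiPerna–Lions' mollified primitive. [cite: DiPernaLions1989, §II.1 (13)–(14)] -/
theorem weak_eq_translate (H : Torus.IsWeakScalarTransportForcedOn (T + a) κ u s θ₀ θ)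
    (ha : 0 < a) (hT : 0 < T)
    (htr : ∀ g : UnitAddTorus d → ℝ, Torus.IsSmooth g →
      ∫ x, θ a x * g x = (∫ y, θ₀ y * g y) + ∫ τ in Ioc 0 a, ((∫ y, θ τ y *
        (⟪u τ y, Torus.gradient g y⟫_ℝ + κ * Torus.laplacian g y)) + ∫ y, s τ y * g y))
    {ψ : ℝ → UnitAddTorus d → ℝ} (hψ : Torus.IsSpaceTimeTest T ψ) :
    (∫ t in Ioo 0 T, ∫ x, θ (t + a) x *
        (Torus.timeDeriv ψ t x + ⟪u (t + a) x, Torus.gradient (ψ t) x⟫_ℝ + κ * Torus.laplacian (ψ t) x)) +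
      (∫ t in Ioo 0 T, ∫ x, s (t + a) x * ψ t x) + ∫ x, θ a x * ψ 0 x = 0 := by
  set μ : Measure (ℝ × UnitAddTorus d) := ((volume : Measure ℝ).restrict (Ioo 0 (T + a))).prod volume
    with hμ
  -- the shifted test function on `[0, T + a)`
  set ψs : ℝ → UnitAddTorus d → ℝ := fun τ => ψ (τ + -a) with hψs_def
  have hψs : Torus.IsSpaceTimeTest (T + a) ψs := by
    have h := hψ.comp_add_right (-a)
    rwa [sub_neg_eq_add] at h
  -- the functionals of `θ` against `ψs` on `(0, T + a)`
  set P : ℝ → ℝ := fun τ => ∫ x, θ τ x * ψs τ x with hP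
  set Φ₀ : ℝ → ℝ := fun τ => ∫ x, θ τ x *
    (Torus.timeDeriv ψs τ x + ⟪u τ x, Torus.gradient (ψs τ) x⟫_ℝ + κ * Torus.laplacian (ψs τ) x) with hΦ₀
  set G : ℝ → ℝ := fun τ => ∫ x, s τ x * ψs τ x with hG
  set Φ : ℝ → ℝ := fun τ => Φ₀ τ + G τ with hΦ
  set L : ℝ := ∫ x, θ a x * ψ 0 x with hL
  -- integrability of the integrands and of the functionals
  have hψsc : Continuous (uncurry ψs) := hψs.continuous_uncurry
  obtain ⟨K, hK⟩ := Torus.exists_bound_of_continuous_uncurry hψsc 0 (T + a)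
  have hPI : Integrable (fun p : ℝ × UnitAddTorus d => θ p.1 p.2 * ψs p.1 p.2) μ := by
    refine Integrable.mono' (H.integrable_uncurry.norm.mul_const K)
      (H.aestronglyMeasurable_uncurry.mul hψsc.aestronglyMeasurable) ?_
    filter_upwards [Torus.IsWeakScalarTransportForcedOn.ae_fst_mem_Ioo (d := d) (T + a)] with p hp
    rw [norm_mul]
    exact mul_le_mul_of_nonneg_left (hK p.1 (Ioo_subset_Icc_self hp) p.2) (norm_nonneg _)
  have hWI := H.integrable_weakIntegrand hψs
  have hGI := H.integrable_source_mul_test hψs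
  have hPi : IntegrableOn P (Ioo 0 (T + a)) := hPI.integral_prod_left
  have hΦ₀i : IntegrableOn Φ₀ (Ioo 0 (T + a)) := hWI.integral_prod_left
  have hGi : IntegrableOn G (Ioo 0 (T + a)) := hGI.integral_prod_left
  have hΦi : IntegrableOn Φ (Ioo 0 (T + a)) := hΦ₀i.add hGi
  -- the cut-offs `η k` with derivatives `ρ k`, at scale `δ k = T / (6 (k + 1))`
  set δ : ℕ → ℝ := fun k => T / (6 * ((k : ℝ) + 1)) with hδ
  have hδ0 : ∀ k, 0 < δ k := fun k => by positivity
  have hδT : ∀ k, 3 * δ k ≤ T := fun k => by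
    have hk : (0 : ℝ) ≤ k := Nat.cast_nonneg k
    have h1 : δ k ≤ T / 6 := by
      show T / (6 * ((k : ℝ) + 1)) ≤ T / 6
      exact div_le_div_of_nonneg_left hT.le (by norm_num) (by nlinarith)
    linarith
  have hδlim : Tendsto δ atTop (𝓝 0) := by
    have h1 : Tendsto (fun k : ℕ => (k : ℝ) + 1) atTop atTop :=
      tendsto_atTop_add_const_right _ 1 tendsto_natCast_atTop_atTop
    have h3 : Tendsto (fun k : ℕ => 6 * ((k : ℝ) + 1)) atTop atTop := h1.const_mul_atTop (by norm_num)
    exact tendsto_const_nhds.div_atTop h3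
  obtain hcut : ∀ k, ∃ η ρ : ℝ → ℝ, ContDiff ℝ (⊤ : ℕ∞) η ∧ Continuous ρ ∧
      (∀ σ, HasDerivAt η (ρ σ) σ) ∧ (∀ σ, σ ≤ δ k → η σ = 0) ∧ (∀ σ, 3 * δ k ≤ σ → η σ = 1) ∧
      (∀ σ, η σ ∈ Icc (0 : ℝ) 1) ∧ (∀ σ, 0 ≤ ρ σ) ∧ (∀ σ, σ ∉ Ioo (δ k) (3 * δ k) → ρ σ = 0) ∧
      ∫ σ, ρ σ = 1 := fun k => exists_smooth_time_cutoff (hδ0 k)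
  choose η ρ hηs hρc hηρ hη0 hη1 hη01 hρ0 hρsupp hρ1 using hcut
  have hηabs : ∀ k σ, |η k σ| ≤ 1 := fun k σ => by
    rw [abs_le]
    exact ⟨by linarith [(hη01 k σ).1], (hη01 k σ).2⟩
  have hρC : ∀ k, ∃ C, 0 ≤ C ∧ ∀ σ, |ρ k σ| ≤ C := fun k =>
    exists_abs_le_of_eq_zero_off_Ioo (hρc k) (hρsupp k)
  have hηks : ∀ k, ContDiff ℝ ∞ (fun τ => η k (τ + -a)) := fun k =>
    (hηs k).comp (contDiff_id.add contDiff_const)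
  have hderiv : ∀ k τ, deriv (fun τ => η k (τ + -a)) τ = ρ k (τ + -a) := fun k τ =>
    (HasDerivAt.comp_add_const τ (-a) (hηρ k (τ + -a))).deriv
  have hηk0 : ∀ k, η k (-a) = 0 := fun k => hη0 k _ (by linarith [hδ0 k])
  -- Step 1: the tested identity for each `k`
  have hAB : ∀ k, (∫ τ in Ioo 0 (T + a), ρ k (τ + -a) * P τ) +
      ∫ τ in Ioo 0 (T + a), η k (τ + -a) * Φ τ = 0 := by
    intro k
    obtain ⟨C, -, hC⟩ := hρC k
    have hΨ : Torus.IsSpaceTimeTest (T + a) (fun τ x => η k (τ + -a) * ψs τ x) := by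
      simpa only [smul_eq_mul] using Torus.isSpaceTimeTest_smul_time (hηks k) hψs
    have key := H.integral_prod_weak_eq hΨ
    have hpt : ∀ p : ℝ × UnitAddTorus d, θ p.1 p.2 *
        (Torus.timeDeriv (fun τ x => η k (τ + -a) * ψs τ x) p.1 p.2 +
          ⟪u p.1 p.2, Torus.gradient (fun x => η k (p.1 + -a) * ψs p.1 x) p.2⟫_ℝ +
          κ * Torus.laplacian (fun x => η k (p.1 + -a) * ψs p.1 x) p.2) =
        ρ k (p.1 + -a) * (θ p.1 p.2 * ψs p.1 p.2) + η k (p.1 + -a) * (θ p.1 p.2 *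
          (Torus.timeDeriv ψs p.1 p.2 + ⟪u p.1 p.2, Torus.gradient (ψs p.1) p.2⟫_ℝ +
            κ * Torus.laplacian (ψs p.1) p.2)) := by
      intro p
      have hC1 : Torus.IsContDiff 1 (ψs p.1) := (hψs.isSmooth_slice p.1).isContDiff (by simp)
      have htd := Torus.timeDeriv_smul' ((hηks k).differentiable (by simp)) hψs.1 p.1 p.2
      simp only [smul_eq_mul, hderiv k] at htd
      rw [htd, Torus.gradient_const_mul hC1, Torus.laplacian_const_mul (hψs.isSmooth_slice p.1),
        real_inner_smul_right]
      ring
    have I1 : Integrable (fun p : ℝ × UnitAddTorus d => ρ k (p.1 + -a) * (θ p.1 p.2 * ψs p.1 p.2)) μ :=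
      hPI.bdd_mul ((hρc k).comp (continuous_fst.add continuous_const)).aestronglyMeasurable
        (ae_of_all _ fun p => by rw [Real.norm_eq_abs]; exact hC _)
    have I2 : Integrable (fun p : ℝ × UnitAddTorus d => η k (p.1 + -a) * (θ p.1 p.2 *
        (Torus.timeDeriv ψs p.1 p.2 + ⟪u p.1 p.2, Torus.gradient (ψs p.1) p.2⟫_ℝ +
          κ * Torus.laplacian (ψs p.1) p.2))) μ :=
      hWI.bdd_mul ((hηs k).continuous.comp (continuous_fst.add continuous_const)).aestronglyMeasurable
        (ae_of_all _ fun p => by rw [Real.norm_eq_abs]; exact hηabs k _)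
    have I3 : Integrable (fun p : ℝ × UnitAddTorus d => η k (p.1 + -a) * (s p.1 p.2 * ψs p.1 p.2)) μ :=
      hGI.bdd_mul ((hηs k).continuous.comp (continuous_fst.add continuous_const)).aestronglyMeasurable
        (ae_of_all _ fun p => by rw [Real.norm_eq_abs]; exact hηabs k _)
    have iηΦ₀ : IntegrableOn (fun τ => η k (τ + -a) * Φ₀ τ) (Ioo 0 (T + a)) :=
      hΦ₀i.bdd_mul ((hηs k).continuous.comp (continuous_id.add continuous_const)).aestronglyMeasurable
        (ae_of_all _ fun τ => by rw [Real.norm_eq_abs]; exact hηabs k _)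
    have iηG : IntegrableOn (fun τ => η k (τ + -a) * G τ) (Ioo 0 (T + a)) :=
      hGi.bdd_mul ((hηs k).continuous.comp (continuous_id.add continuous_const)).aestronglyMeasurable
        (ae_of_all _ fun τ => by rw [Real.norm_eq_abs]; exact hηabs k _)
    have e1 : (∫ p, θ p.1 p.2 *
        (Torus.timeDeriv (fun τ x => η k (τ + -a) * ψs τ x) p.1 p.2 +
          ⟪u p.1 p.2, Torus.gradient (fun x => η k (p.1 + -a) * ψs p.1 x) p.2⟫_ℝ +
          κ * Torus.laplacian (fun x => η k (p.1 + -a) * ψs p.1 x) p.2) ∂μ) =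
        (∫ τ in Ioo 0 (T + a), ρ k (τ + -a) * P τ) + ∫ τ in Ioo 0 (T + a), η k (τ + -a) * Φ₀ τ := by
      rw [integral_congr_ae (ae_of_all _ hpt), integral_add I1 I2, integral_prod _ I1, integral_prod _ I2]
      dsimp only
      congr 1
      · exact integral_congr_ae (ae_of_all _ fun τ => MeasureTheory.integral_const_mul _ _)
      · exact integral_congr_ae (ae_of_all _ fun τ => MeasureTheory.integral_const_mul _ _)
    have e2 : (∫ p, s p.1 p.2 * (η k (p.1 + -a) * ψs p.1 p.2) ∂μ) =
        ∫ τ in Ioo 0 (T + a), η k (τ + -a) * G τ := by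
      have e : (fun p : ℝ × UnitAddTorus d => s p.1 p.2 * (η k (p.1 + -a) * ψs p.1 p.2)) =
          fun p => η k (p.1 + -a) * (s p.1 p.2 * ψs p.1 p.2) := by
        funext p; ring
      rw [e, integral_prod _ I3]
      dsimp only
      exact integral_congr_ae (ae_of_all _ fun τ => MeasureTheory.integral_const_mul _ _)
    have e3 : (∫ x, θ₀ x * (η k (0 + -a) * ψs 0 x)) = 0 := by simp [hηk0 k]
    rw [e1, e2, e3, add_zero] at key
    have e4 : (∫ τ in Ioo 0 (T + a), η k (τ + -a) * Φ τ) =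
        (∫ τ in Ioo 0 (T + a), η k (τ + -a) * Φ₀ τ) + ∫ τ in Ioo 0 (T + a), η k (τ + -a) * G τ := by
      rw [← integral_add iηΦ₀ iηG]
      exact integral_congr_ae (ae_of_all _ fun τ => mul_add _ _ _)
    rw [e4]
    linarith
  -- Step 2a: `∫ η_k(τ - a) Φ(τ) dτ → ∫_{(a, T+a)} Φ`
  have hA : Tendsto (fun k => ∫ τ in Ioo 0 (T + a), η k (τ + -a) * Φ τ) atTop
      (𝓝 (∫ τ in Ioo a (T + a), Φ τ)) := by
    have hset : Ioo 0 (T + a) ∩ Ioi a = Ioo a (T + a) := by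
      ext τ
      simp only [mem_Ioo, mem_inter_iff, mem_Ioi]
      constructor
      · rintro ⟨⟨-, h2⟩, h1⟩; exact ⟨h1, h2⟩
      · rintro ⟨h1, h2⟩; exact ⟨⟨ha.trans h1, h2⟩, h1⟩
    have hlim : ∫ τ in Ioo a (T + a), Φ τ = ∫ τ in Ioo 0 (T + a), (Ioi a).indicator Φ τ := by
      rw [setIntegral_indicator measurableSet_Ioi, hset]
    rw [hlim]
    refine tendsto_integral_of_dominated_convergence (fun τ => ‖Φ τ‖)
      (fun k => (((hηs k).continuous.comp (continuous_id.add continuous_const)).aestronglyMeasurable.mul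
        hΦi.aestronglyMeasurable)) hΦi.norm (fun k => ae_of_all _ fun τ => ?_) (ae_of_all _ fun τ => ?_)
    · rw [norm_mul, Real.norm_eq_abs]
      exact mul_le_of_le_one_left (norm_nonneg _) (hηabs k _)
    · by_cases hτ : τ ∈ Ioi a
      · rw [indicator_of_mem hτ]
        have hτs : 0 < τ + -a := by linarith [mem_Ioi.1 hτ]
        have h3 : Tendsto (fun k => 3 * δ k) atTop (𝓝 0) := by
          simpa using hδlim.const_mul 3
        have hev : ∀ᶠ k in atTop, 3 * δ k < τ + -a := (tendsto_order.1 h3).2 _ hτs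
        refine (tendsto_const_nhds (x := Φ τ)).congr' ?_
        filter_upwards [hev] with k hk
        show Φ τ = η k (τ + -a) * Φ τ
        rw [hη1 k _ hk.le, one_mul]
      · rw [indicator_of_notMem hτ]
        have hτs : τ + -a ≤ 0 := by
          have := not_lt.1 (mt mem_Ioi.2 hτ)
          linarith
        refine (tendsto_const_nhds (x := (0 : ℝ))).congr' (Eventually.of_forall fun k => ?_)
        show (0 : ℝ) = η k (τ + -a) * Φ τ
        rw [hη0 k _ (hτs.trans (hδ0 k).le), zero_mul]
  -- Step 2b: `∫ ρ_k(τ - a) P(τ) dτ → ∫ θ(a) ψ(0)`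
  have hB : Tendsto (fun k => ∫ τ in Ioo 0 (T + a), ρ k (τ + -a) * P τ) atTop (𝓝 L) := by
    set U : ℝ → ℝ := fun t => ∫ x, θ (t + a) x * ψ t x with hU
    have hcv : ∀ k, ∫ τ in Ioo 0 (T + a), ρ k (τ + -a) * P τ = ∫ t in Ioo 0 T, ρ k t * U t := by
      intro k
      have h1 := setIntegral_Ioo_comp_add_right (fun τ => ρ k (τ + -a) * P τ) (-a) T a
      rw [neg_add_cancel] at h1
      rw [← h1]
      have hpt : ∀ t, ρ k (t + a + -a) * P (t + a) = ρ k t * U t := by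
        intro t
        simp only [hP, hU, hψs_def, add_neg_cancel_right]
      simp only [hpt]
      refine setIntegral_eq_of_subset_of_forall_sdiff_eq_zero measurableSet_Ioo
        (Ioo_subset_Ioo_left (by linarith)) fun t ht => ?_
      have hts : t ≤ 0 := by
        by_contra hc
        exact ht.2 ⟨not_le.1 hc, ht.1.2⟩
      rw [hρsupp k t (fun h' => by linarith [h'.1, hδ0 k]), zero_mul]
    simp_rw [hcv]
    have hUi : IntegrableOn U (Ioo 0 T) := by
      have h1 : IntegrableOn (fun t => P (a + t)) (Ioo 0 T) :=
        Torus.integrableOn_Ioo_comp_add_left (hPi.mono_set fun t ht => ⟨ha.trans ht.1, by linarith [ht.2]⟩)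
      refine h1.congr_fun (fun t _ => ?_) measurableSet_Ioo
      simp only [hP, hU, hψs_def]
      rw [add_comm a t, add_neg_cancel_right]
    have hlim := exists_ae_abs_pairing_translate_sub_le H ha hT hψ (htr (ψ 0) (hψ.isSmooth_slice 0))
    exact tendsto_setIntegral_mul_of_ae_tendsto hUi hlim hδlim hδ0 hδT hρc hρ0 hρsupp hρ1
  -- Step 3: the limit identity on `(a, T + a)`
  have hsum : L + ∫ τ in Ioo a (T + a), Φ τ = 0 :=
    tendsto_nhds_unique (hB.add hA) (by simpa only [hAB] using tendsto_const_nhds)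
  -- Step 4: change variables `τ = t + a`
  have hslice : ∀ t, ψs (t + a) = ψ t := fun t => by
    funext y
    simp [hψs_def]
  have hder : ∀ t y, Torus.timeDeriv ψs (t + a) y = Torus.timeDeriv ψ t y := fun t y => by
    rw [hψs_def, Torus.timeDeriv_comp_add_right ψ (-a) (t + a) y, add_neg_cancel_right]
  have htrans : ∀ {F : ℝ → ℝ}, IntegrableOn F (Ioo 0 (T + a)) → IntegrableOn (fun t => F (t + a)) (Ioo 0 T) := by
    intro F hF
    have h1 : IntegrableOn (fun t => F (a + t)) (Ioo 0 T) :=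
      Torus.integrableOn_Ioo_comp_add_left (hF.mono_set fun t ht => ⟨ha.trans ht.1, by linarith [ht.2]⟩)
    exact h1.congr_fun (fun t _ => by rw [add_comm]) measurableSet_Ioo
  have hcv : ∫ τ in Ioo a (T + a), Φ τ = (∫ t in Ioo 0 T, ∫ x, θ (t + a) x *
      (Torus.timeDeriv ψ t x + ⟪u (t + a) x, Torus.gradient (ψ t) x⟫_ℝ + κ * Torus.laplacian (ψ t) x)) +
      ∫ t in Ioo 0 T, ∫ x, s (t + a) x * ψ t x := by
    have h1 := setIntegral_Ioo_comp_add_right Φ 0 T a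
    rw [zero_add] at h1
    rw [← h1]
    simp only [hΦ]
    rw [integral_add (htrans hΦ₀i) (htrans hGi)]
    congr 1
    · refine setIntegral_congr_fun measurableSet_Ioo fun t _ => ?_
      simp only [hΦ₀, hder]
      rw [hslice]
    · refine setIntegral_congr_fun measurableSet_Ioo fun t _ => ?_
      simp only [hG]
      rw [hslice]
  rw [hcv] at hsum
  linarith

/-- **The translate of a sourced weak passive scalar from a good time is a weak solution from
its slice.** If `θ` is a weak solution of `∂ₜθ + u·∇θ = κΔθ + s` on `T^d × [0, T + a)`
(`T, a > 0`) and the slice `θ(a)` paired with every smooth `g` is the trace `P_g(a)`, then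
`θ(· + a)` is a weak solution on `T^d × [0, T)` over the drift `u(· + a)` and source `s(· + a)`
with datum `θ(a)`: measurability, the `L^∞L²`, `L¹L²`, `L¹` clauses and weak incompressibility
translate along the measure-preserving shear `(t, y) ↦ (t + a, y)`, and the weak identity with
datum is `weak_eq_translate`. [cite: DiPernaLions1989, §II.1 (13)–(14)] -/
theorem isWeakScalarTransportForcedOn_translate
    (H : Torus.IsWeakScalarTransportForcedOn (T + a) κ u s θ₀ θ) (ha : 0 < a) (hT : 0 < T)
    (htr : ∀ g : UnitAddTorus d → ℝ, Torus.IsSmooth g →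
      ∫ x, θ a x * g x = (∫ y, θ₀ y * g y) + ∫ τ in Ioc 0 a, ((∫ y, θ τ y *
        (⟪u τ y, Torus.gradient g y⟫_ℝ + κ * Torus.laplacian g y)) + ∫ y, s τ y * g y)) :
    Torus.IsWeakScalarTransportForcedOn T κ (fun t => u (t + a)) (fun t => s (t + a)) (θ a)
      (fun t => θ (t + a)) := by
  have hsub : Ioo (0 + a) (T + a) ⊆ Ioo 0 (T + a) := fun t ht => ⟨by linarith [ht.1], ht.2⟩
  have hμ : volume.restrict (Ioo (0 + a) (T + a)) ≤ volume.restrict (Ioo 0 (T + a)) :=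
    Measure.restrict_mono hsub le_rfl
  obtain ⟨C, hC⟩ := H.ae_lintegral_sq_le
  refine ⟨Torus.aestronglyMeasurable_stLift_translate ha.le le_rfl H.aestronglyMeasurable,
    Torus.aestronglyMeasurable_stLift_translate ha.le le_rfl H.aestronglyMeasurable_velocity,
    Torus.aestronglyMeasurable_stLift_translate ha.le le_rfl H.aestronglyMeasurable_source,
    ⟨C, ae_restrict_Ioo_comp_add_right a (ae_mono hμ hC)⟩, ?_, ?_, ?_,
    ae_restrict_Ioo_comp_add_right a (ae_mono hμ H.ae_isWeaklyDivFree),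
    fun ψ hψ => weak_eq_translate H ha hT htr hψ⟩
  · rw [setLIntegral_Ioo_comp_add_right (fun t => (∫⁻ x, ‖u t x‖ₑ ^ 2) ^ (1 / 2 : ℝ)) 0 T a]
    exact (lintegral_mono_set hsub).trans_lt H.lintegral_velocity_lt_top
  · rw [setLIntegral_Ioo_comp_add_right (fun t => ∫⁻ x, ‖u t x‖ₑ * ‖θ t x‖ₑ) 0 T a]
    exact (lintegral_mono_set hsub).trans_lt H.lintegral_mul_lt_top
  · rw [setLIntegral_Ioo_comp_add_right (fun t => ∫⁻ x, ‖s t x‖ₑ) 0 T a]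
    exact (lintegral_mono_set hsub).trans_lt H.lintegral_source_lt_top

end Translate

/-- **RC-R `stub_rcRestart` — weak sourced scalars restart at a.e. time.** For a global weak
solution `θ` of `∂ₜθ + u·∇θ = κΔθ + h` on `T²` (steady smooth source, `L²` datum), for a.e.
`a > 0` the slice `θ a` is in `L²` and the time-shifted field `t ↦ θ (a + t)` is a global weak
solution over the shifted drift `t ↦ u (a + t)` with datum `θ a`. The good times are those of
`ae_memLp_and_forall_integral_mul_eq_trace` (a null set independent of the test function: along a
fixed sequence of kernels the mollified solution equals its continuous mollified primitive, so that
`(θ a, g) = P_g(a)` for every smooth `g`), at which `isWeakScalarTransportForcedOn_translate`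
applies on every horizon. [cite: DiPernaLions1989, §II.1 (13)–(14)] -/
theorem stub_rcRestart :
    ∀ (κ : ℝ) (u : ℝ → UnitAddTorus (Fin 2) → EuclideanSpace ℝ (Fin 2))
      (h θ₀ : UnitAddTorus (Fin 2) → ℝ) (θ : ℝ → UnitAddTorus (Fin 2) → ℝ),
      Torus.IsSmooth h → MemLp θ₀ 2 volume →
      Torus.IsWeakScalarTransportForced κ u (fun _ => h) θ₀ θ →
      ∀ᵐ a ∂(volume.restrict (Set.Ioi (0 : ℝ))),
        MemLp (θ a) 2 volume ∧
        Torus.IsWeakScalarTransportForced κ (fun t => u (a + t)) (fun _ => h) (θ a) (fun t => θ (a + t)) := by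
  intro κ u h θ₀ θ _ hθ₀ hsol
  filter_upwards [ae_memLp_and_forall_integral_mul_eq_trace hsol (hθ₀.integrable one_le_two),
    ae_restrict_mem measurableSet_Ioi] with a ha ha0
  obtain ⟨hmem, htr⟩ := ha
  refine ⟨hmem, fun T hT => ?_⟩
  have ha0' : 0 < a := ha0
  have eu : (fun t => u (a + t)) = fun t => u (t + a) := funext fun t => by rw [add_comm]
  have eθ : (fun t => θ (a + t)) = fun t => θ (t + a) := funext fun t => by rw [add_comm]
  rw [eu, eθ]
  exact isWeakScalarTransportForcedOn_translate (hsol (T + a) (by linarith)) ha0' hT htr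

end Summit.AnomalousDissipation.AnomalousDissipation.Theorems.TwohalfdNeg.RegularCondensate

end
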